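import Literature.AlgebraicGeometry.Resolution.ResolutionLU
import HarnessLib

/-!
# `LocalToGlobal` (crux stmt-ResolutionOfSingularities-15232): a resolution of a NEIGHBOURHOOD of
# the centre uniformizes the valuation ring

Route `ResolutionOfSingularities/UniversalCells`, crux #4 `LocalToGlobal`
(`∀ p prime, H_p → R_p`: pointwise Zariski-local resolvability of every integral separated
finite-type `𝔽_p`-scheme ⇒ resolution of every such scheme). The crux's docstring asserts that
"Zariski-local resolutions give relative local uniformization along every valuation (centre of
the valuation on the local resolution)". This file proves the scheme-theoretic core of that
sentence, the LOCAL form of the folklore implication "resolution ⇒ local uniformization":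

* `exists_fg_regular_of_hasResolution_nhds` — `Literature…ResolutionLU.exists_fg_regular_of_hasResolution`
  asks for a resolution of all of `Spec A`; here only an open neighbourhood `W` of the CENTRE of
  the valuation ring `O ⊇ A` on `Spec A` is resolved. The valuative criterion of properness is
  applied to the resolution `π : X → W`, after lifting `Spec O → Spec A` into `W` (every point of
  `Spec O` specialises to the closed point, whose image is the centre `∈ W`) and the generic point
  `Spec K → Spec A` into the dense open of `W` over which `π` is an isomorphism; the rest of the
  argument (regular centre `x' ∈ X`, `𝒪_{X,x'} ↪ O`, an affine chart of finite type over `A`) is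
  the proof of `exists_fg_regular_of_hasResolution` verbatim, with `π ≫ W.ι` for `π`.
* `exists_fg_regular_of_locallyResolvable` — the same with the hypothesis in pointwise form
  (every point of `Spec A` has a resolvable open neighbourhood).

The consequences over a ground field and at the prime field of the crux (`H_p ⇒ LUrel(𝔽_p)`,
`localToGlobal_of_patching_primeField`) are in
`UniversalCellsLocalToGlobalLocalUniformization.lean`.
-/

noncomputable section

-- single-problem summit: the doubled namespace component `ResolutionOfSingularities` is forced
set_option linter.dupNamespace false

open CategoryTheory AlgebraicGeometry TopologicalSpace IsLocalRing
open Literature.AlgebraicGeometry.Resolution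

namespace Summit.ResolutionOfSingularities.ResolutionOfSingularities.Theorems

universe u

/-! ## A resolution of a neighbourhood of the centre uniformizes the valuation ring -/

section Main

variable {A : Type u} [CommRing A] [IsDomain A] {K : Type u} [Field K] [Algebra A K]
  [IsFractionRing A K]

/-- **Local resolution implies local uniformization** (the folklore implication "resolution ⇒
local uniformization", Zariski 1940 read backwards, in its LOCAL form): let `A` be a domain with
fraction field `K`, `O` a valuation ring of `K` containing `A`, and `W ⊆ Spec A` an open
neighbourhood of the centre of `O` on `Spec A` (the image of the closed point of `Spec O`). If
`W` admits a proper birational `π : X → W` with `X` regular, then some finitely generated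
`A`-subalgebra `T ⊆ O` of `K` is regular at the centre `𝔪_O ∩ T`. Proof: `Spec O → Spec A`
factors through `W` (all points of `Spec O` specialise to the closed point), the generic point
`Spec K → Spec A` factors through the dense open of `W` over which `π` is an isomorphism, the
valuative criterion of properness for `π` gives a lift `l : Spec O → X`, and then the argument
of `exists_fg_regular_of_hasResolution` applies verbatim to `π ≫ W.ι : X → Spec A` (regular,
hence integral, centre `x' = l(𝔪_O)`; `𝒪_{X,x'} ↪ O`; an affine chart `V ∋ x'` of finite
type over `A`; `T :=` the image of `Γ(X, V)` in `K`, `T_{𝔪_O ∩ T} ≅ 𝒪_{X,x'}`). [folklore] -/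
theorem exists_fg_regular_of_hasResolution_nhds (O : ValuationSubring K)
    (hAO : ∀ a : A, algebraMap A K a ∈ O) (W : (Spec (.of A)).Opens)
    (hW : (Spec.map (CommRingCat.ofHom ((algebraMap A K).codRestrict O.toSubring hAO))).base
      (closedPoint O) ∈ W)
    (hres : Scheme.HasResolution (W : Scheme.{u})) :
    ∃ (T : Subalgebra A K) (h : T.toSubring ≤ O.toSubring), T.FG ∧
      IsRegularLocalRing (Localization.AtPrime
        (Ideal.comap (Subring.inclusion h) (IsLocalRing.maximalIdeal O))) := by
  classical
  obtain ⟨X, π, hπ⟩ := hres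
  haveI := hπ.isProper
  obtain ⟨U, hUd, -, hUiso⟩ := hπ.isBirational
  haveI : IsDomain (CommRingCat.of A) := ‹IsDomain A›
  -- the ring maps `A → O → K`
  let φ₀ : A →+* O := (algebraMap A K).codRestrict O.toSubring hAO
  let ιOK : CommRingCat.of O ⟶ CommRingCat.of K := CommRingCat.ofHom (algebraMap O K)
  let i₂ : Spec (.of O) ⟶ Spec (.of A) := Spec.map (CommRingCat.ofHom φ₀)
  change i₂.base (closedPoint O) ∈ W at hW
  let g : Spec (.of K) ⟶ Spec (.of A) := Spec.map (CommRingCat.ofHom (algebraMap A K))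
  have hg : Spec.map ιOK ≫ i₂ = g := by
    rw [← Spec.map_comp]
    rfl
  -- the generic point of `Spec A` lies in (the image of) `U`
  let q : Spec (.of K) := closedPoint K
  have hgq : g q = (⊥ : PrimeSpectrum A) := by
    change PrimeSpectrum.comap (algebraMap A K) (closedPoint K) = ⊥
    ext1
    rw [PrimeSpectrum.comap_asIdeal]
    change Ideal.comap (algebraMap A K) (maximalIdeal K) = ⊥
    rw [maximalIdeal_eq_bot, ← RingHom.ker_eq_comap_bot, RingHom.ker_eq_bot_iff_eq_zero]
    intro a ha
    exact (IsFractionRing.injective A K) (by rw [ha, map_zero])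
  -- the open immersion `e : U ↪ W ↪ Spec A`
  let e : (U : Scheme.{u}) ⟶ Spec (.of A) := U.ι ≫ W.ι
  haveI : IsOpenImmersion e := inferInstance
  haveI : Nonempty (W : Scheme.{u}) := ⟨⟨_, hW⟩⟩
  have hrange : Set.range g.base ⊆ Set.range e.base := by
    rintro _ ⟨p, rfl⟩
    obtain rfl : p = q := Subsingleton.elim _ _
    rw [hgq]
    obtain ⟨y, hy⟩ := hUd.nonempty
    have hey : e.base ⟨y, hy⟩ ∈ Set.range e.base := ⟨_, rfl⟩
    exact ((PrimeSpectrum.le_iff_specializes _ (e.base ⟨y, hy⟩)).mp bot_le).mem_open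
      e.isOpenEmbedding.isOpen_range hey
  let g₁ : Spec (.of K) ⟶ U := IsOpenImmersion.lift e g hrange
  have hg₁ : g₁ ≫ U.ι ≫ W.ι = g := IsOpenImmersion.lift_fac _ _ _
  haveI := hUiso
  let j : ↑(π ⁻¹ᵁ U) ⟶ X := (π ⁻¹ᵁ U).ι
  let i₁ : Spec (.of K) ⟶ X := g₁ ≫ inv (π ∣_ U) ≫ j
  -- `Spec O → Spec A` factors through `W`: every point specialises to the closed point
  have hrange₂ : Set.range i₂.base ⊆ Set.range W.ι.base := by
    rw [Scheme.Opens.range_ι]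
    rintro _ ⟨s, rfl⟩
    have hs : s ⤳ closedPoint O := IsLocalRing.specializes_closedPoint s
    exact (hs.map i₂.base.hom.continuous).mem_open W.2 hW
  let i₂' : Spec (.of O) ⟶ W := IsOpenImmersion.lift W.ι i₂ hrange₂
  have hi₂' : i₂' ≫ W.ι = i₂ := IsOpenImmersion.lift_fac _ _ _
  have hsq : i₁ ≫ π = Spec.map ιOK ≫ i₂' := by
    rw [← cancel_mono W.ι]
    simp only [Category.assoc, hi₂', hg]
    simp only [i₁, j, Category.assoc]
    rw [← morphismRestrict_ι_assoc, IsIso.inv_hom_id_assoc, hg₁]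
  -- valuative criterion of properness
  have hex : ValuativeCriterion.Existence π := by
    have h := (inferInstance : UniversallyClosed π)
    rw [UniversallyClosed.eq_valuativeCriterion] at h
    exact h.1
  obtain ⟨l, hl₁, hl₂⟩ :=
    (hex { R := O, K := K, i₁ := i₁, i₂ := i₂', commSq := ⟨hsq⟩ }).exists_lift
  -- `π' = π ≫ W.ι : X → Spec A`
  let π' : X ⟶ Spec (.of A) := π ≫ W.ι
  have hl₂' : l ≫ π' = i₂ := by
    change l ≫ π ≫ W.ι = i₂
    rw [← Category.assoc, hl₂, hi₂']
  -- the centre `x' = l(𝔪_O)` and its regular (hence integral) local ring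
  set c : Spec (.of O) := closedPoint O with hc
  haveI hregx : IsRegularLocalRing (X.presheaf.stalk (l c)) := hπ.isRegular (l c)
  haveI : IsDomain (X.presheaf.stalk (l c)) := Matsumura1987_14_3_holds _ hregx
  let ψ := Scheme.stalkClosedPointTo l
  -- `ψ : 𝒪_{X,x'} → O` is injective
  have hψ : Function.Injective ψ := by
    let γ₀ : Spec (.of O) := Spec.map ιOK q
    have hγc : γ₀ ⤳ c := IsLocalRing.specializes_closedPoint γ₀
    -- (E1) at the generic point
    have hE1 : Function.Injective (l.stalkMap γ₀) := by
      have h1 : Function.Injective (g.stalkMap q) := by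
        have hF : IsField ((Spec (.of A)).presheaf.stalk (g q)) := by
          refine isField_stalk_of_eq ?_ (Field.toIsField (Spec (.of A)).functionField)
          rw [genericPoint_eq_bot_of_affine, hgq]
        letI := hF.toField
        exact RingHom.injective _
      have h2 : Function.Injective (g₁.stalkMap q) := by
        rw [← stalkMap_injective_congr hg₁, Scheme.Hom.stalkMap_comp] at h1
        exact Function.Injective.of_comp_right h1
          (ConcreteCategory.bijective_of_isIso ((U.ι ≫ W.ι).stalkMap (g₁ q))).2
      have h3 : Function.Injective (i₁.stalkMap q) := by
        change Function.Injective ((g₁ ≫ inv (π ∣_ U) ≫ j).stalkMap q)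
        rw [Scheme.Hom.stalkMap_comp]
        exact h2.comp (ConcreteCategory.bijective_of_isIso ((inv (π ∣_ U) ≫ j).stalkMap _)).1
      rw [← stalkMap_injective_congr hl₁, Scheme.Hom.stalkMap_comp] at h3
      have h4 : Function.Injective ((Spec.map ιOK).stalkMap q ∘ l.stalkMap γ₀) := h3
      exact Function.Injective.of_comp h4
    -- (E2) generisation on `X` at the domain `𝒪_{X,x'}`
    have hE2 := stalkSpecializes_injective_of_isDomain (l.base.hom.map_specializes hγc)
    have hE := Scheme.Hom.stalkSpecializes_stalkMap l γ₀ c hγc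
    have hcomp : Function.Injective
        (l.stalkMap c ≫ (Spec (.of O)).presheaf.stalkSpecializes hγc) := by
      rw [← hE, CategoryTheory.hom_comp]
      exact hE1.comp hE2
    rw [CategoryTheory.hom_comp] at hcomp
    have hl : Function.Injective (l.stalkMap c) := Function.Injective.of_comp hcomp
    change Function.Injective (l.stalkMap c ≫ (stalkClosedPointIso (.of O)).hom)
    rw [CategoryTheory.hom_comp]
    exact (ConcreteCategory.bijective_of_isIso (stalkClosedPointIso (.of O)).hom).1.comp hl
  -- an affine neighbourhood `V ∋ x'`, of finite type over `A` (via `π' = π ≫ W.ι`)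
  obtain ⟨_, ⟨V, hV : IsAffineOpen V, rfl⟩, hxV, -⟩ :=
    X.isBasis_affineOpens.exists_subset_of_mem_open (Set.mem_univ (l c)) isOpen_univ
  have hft : (π'.appLE ⊤ V le_top).hom.FiniteType :=
    HasRingHomProperty.appLE (P := @LocallyOfFiniteType) π' inferInstance ⟨⊤, isAffineOpen_top _⟩
      ⟨V, hV⟩ le_top
  let α : A →+* Γ(X, V) := (π'.appLE ⊤ V le_top).hom.comp (Scheme.ΓSpecIso (.of A)).inv.hom
  have hα : α.FiniteType :=
    hft.comp (RingHom.FiniteType.of_surjective _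
      (Scheme.ΓSpecIso (.of A)).symm.commRingCatIsoToRingEquiv.surjective)
  let β : Γ(X, V) →+* O := ψ.hom.comp (X.presheaf.germ V (l c) hxV).hom
  -- compatibility `β ∘ α = (A → O)`
  have key1 : π'.appLE ⊤ V le_top ≫ X.presheaf.germ V (l c) hxV =
      (Spec (.of A)).presheaf.germ ⊤ (π' (l c)) trivial ≫ π'.stalkMap (l c) := by
    rw [Scheme.Hom.germ_stalkMap, Scheme.Hom.appLE, Category.assoc, TopCat.Presheaf.germ_res]
  have key2 : (Spec (.of A)).presheaf.germ ⊤ ((l ≫ π') c) trivial ≫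
      Scheme.stalkClosedPointTo (l ≫ π') =
        (Scheme.ΓSpecIso (.of A)).hom ≫ CommRingCat.ofHom φ₀ := by
    rw [germ_stalkClosedPointTo_congr hl₂' ⊤ trivial]
    exact Scheme.germ_stalkClosedPointTo_Spec (CommRingCat.ofHom φ₀)
  have key3 : (Spec (.of A)).presheaf.germ ⊤ (π' (l c)) trivial ≫ π'.stalkMap (l c) ≫ ψ =
      (Scheme.ΓSpecIso (.of A)).hom ≫ CommRingCat.ofHom φ₀ := by
    rw [← key2, Scheme.stalkClosedPointTo_comp]
    rfl
  have key : (Scheme.ΓSpecIso (.of A)).inv ≫ π'.appLE ⊤ V le_top ≫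
      X.presheaf.germ V (l c) hxV ≫ ψ = CommRingCat.ofHom φ₀ := by
    rw [← Category.assoc (π'.appLE ⊤ V le_top), key1, Category.assoc, key3, Iso.inv_hom_id_assoc]
  have hβα : ∀ a, β (α a) = φ₀ a := fun a => by
    have := ConcreteCategory.congr_hom key a
    simp only [CategoryTheory.comp_apply, CommRingCat.hom_ofHom] at this
    exact this
  -- the prime of `Γ(X, V)` at `x'` is the preimage of `𝔪_O`
  letI algx := X.presheaf.algebra_section_stalk (⟨l c, hxV⟩ : V)
  have hlocx := hV.isLocalization_stalk ⟨l c, hxV⟩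
  set 𝔮 := (hV.primeIdealOf ⟨l c, hxV⟩).asIdeal with h𝔮def
  have h𝔮 : 𝔮 = Ideal.comap β (maximalIdeal O) := by
    rw [h𝔮def, IsAffineOpen.primeIdealOf_eq_map_closedPoint, Spec.map_apply,
      PrimeSpectrum.comap_asIdeal]
    change Ideal.comap (X.presheaf.germ V (l c) hxV).hom (maximalIdeal _) =
      Ideal.comap (ψ.hom.comp (X.presheaf.germ V (l c) hxV).hom) (maximalIdeal O)
    rw [← Ideal.comap_comap, IsLocalRing.maximalIdeal_comap ψ.hom]
  -- the uniformizing algebra `T = image of Γ(X, V)` in `K`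
  letI : Algebra A Γ(X, V) := α.toAlgebra
  haveI : Algebra.FiniteType A Γ(X, V) := hα
  let γ : Γ(X, V) →ₐ[A] K :=
    { (algebraMap O K).comp β with
      commutes' := fun a => by
        change algebraMap O K (β (α a)) = algebraMap A K a
        rw [hβα]; rfl }
  let T : Subalgebra A K := γ.range
  have hTfg : T.FG := by
    change (γ.range).FG
    rw [← Algebra.map_top]; exact Subalgebra.FG.map _ Algebra.FiniteType.out
  have hTO : T.toSubring ≤ O.toSubring := by
    rintro _ ⟨b, rfl⟩; exact (β b).2
  refine ⟨T, hTO, hTfg, ?_⟩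
  set P := Ideal.comap (Subring.inclusion hTO) (maximalIdeal O) with hP
  let γ' : Γ(X, V) →+* T := γ.rangeRestrict.toRingHom
  have hγ' : ∀ b, ((γ' b : T) : K) = (β b : K) := fun b => rfl
  have hγ'sur : Function.Surjective γ' := AlgHom.rangeRestrict_surjective γ
  have hPq : Ideal.comap γ' P = 𝔮 := by
    ext b
    rw [h𝔮]
    change Subring.inclusion hTO (γ' b) ∈ maximalIdeal O ↔ β b ∈ maximalIdeal O
    rw [show Subring.inclusion hTO (γ' b) = β b from Subtype.ext rfl]
  have hMle : 𝔮.primeCompl ≤ P.primeCompl.comap γ' := fun b hb hb' => hb (by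
    rw [← hPq]; exact hb')
  let δ : X.presheaf.stalk (l c) →+* Localization.AtPrime P :=
    IsLocalization.map (Localization.AtPrime P) γ' hMle
  have hδsurj : Function.Surjective δ := by
    intro z
    obtain ⟨t, u, rfl⟩ := IsLocalization.exists_mk'_eq P.primeCompl z
    obtain ⟨b, rfl⟩ := hγ'sur t
    obtain ⟨s, hs⟩ := hγ'sur u
    have hsq : s ∉ 𝔮 := by
      intro hs𝔮
      rw [← hPq, Ideal.mem_comap, hs] at hs𝔮
      exact u.2 hs𝔮
    refine ⟨IsLocalization.mk' _ b (⟨s, hsq⟩ : 𝔮.primeCompl), ?_⟩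
    rw [IsLocalization.map_mk']
    congr 1
    exact Subtype.ext hs
  have hδinj : Function.Injective δ := by
    rw [injective_iff_map_eq_zero]
    intro z hz
    obtain ⟨b, s, rfl⟩ := IsLocalization.exists_mk'_eq 𝔮.primeCompl z
    rw [IsLocalization.map_mk', IsLocalization.mk'_eq_zero_iff] at hz
    obtain ⟨⟨m, hm⟩, hmb⟩ := hz
    have hm0 : m ≠ 0 := fun h => hm (by rw [h]; exact P.zero_mem)
    have hb0 : γ' b = 0 := (mul_eq_zero.mp hmb).resolve_left hm0
    have hβb : β b = 0 := by
      have h1 : ((γ' b : T) : K) = 0 := by rw [hb0]; rfl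
      rw [hγ'] at h1
      exact_mod_cast h1
    have hgerm : X.presheaf.germ V (l c) hxV b = 0 :=
      hψ (by rw [map_zero]; exact hβb)
    rw [IsLocalization.mk'_eq_mul_mk'_one]
    change X.presheaf.germ V (l c) hxV b * _ = 0
    rw [hgerm, zero_mul]
  exact IsRegularLocalRing.of_ringEquiv (RingEquiv.ofBijective δ ⟨hδinj, hδsurj⟩)

end Main

/-- The same with the hypothesis in POINTWISE form (universe `0`, the universe of the crux): if
every point of `Spec A` has an open neighbourhood with a resolution, every valuation ring
`O ⊇ A` of `K = Frac A` is uniformized by a finitely generated `A`-subalgebra `T ⊆ O` (apply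
`exists_fg_regular_of_hasResolution_nhds` at the centre). Registered certificate sub-goal of
crux stmt-ResolutionOfSingularities-15232 (line `birth`, lead c2). [folklore] -/
theorem exists_fg_regular_of_locallyResolvable (A : Type) [CommRing A] [IsDomain A] (K : Type)
    [Field K] [Algebra A K] [IsFractionRing A K] (O : ValuationSubring K)
    (hAO : ∀ a : A, algebraMap A K a ∈ O)
    (hloc : ∀ x : AlgebraicGeometry.Spec (.of A), ∃ W : (AlgebraicGeometry.Spec (.of A)).Opens,
      x ∈ W ∧ Literature.AlgebraicGeometry.Resolution.Scheme.HasResolution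
        (W : AlgebraicGeometry.Scheme.{0})) :
    ∃ (T : Subalgebra A K) (h : T.toSubring ≤ O.toSubring), T.FG ∧
      IsRegularLocalRing (Localization.AtPrime
        (Ideal.comap (Subring.inclusion h) (IsLocalRing.maximalIdeal O))) := by
  obtain ⟨W, hW, hres⟩ := hloc
    ((Spec.map (CommRingCat.ofHom ((algebraMap A K).codRestrict O.toSubring hAO))).base
      (closedPoint O))
  exact exists_fg_regular_of_hasResolution_nhds O hAO W hW hres


end Summit.ResolutionOfSingularities.ResolutionOfSingularities.Theorems

end
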